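import Summits.BirchSwinnertonDyer.BirchSwinnertonDyer.Theorems.KatoDescentTamePotSupersingularJetchevIrreducibleReadingThm52NamedPrintOnlyPB2
import Summits.BirchSwinnertonDyer.BirchSwinnertonDyer.Theorems.KatoDescentTamePotSupersingularJetchevIrreducibleProp47OfGross37
import HarnessLib

/-!
# Crux `JetchevIrreducibleReadingByName` (item 20165, shared K8-t′ / K9) — the node with stub S5 REPLACED BY THE PUBLISHED FACT it
# rests on: `Sig.H63IRowObjectsAddv` ⟸ {Gross 1991 Prop. 3.7 (2), hPT, hGZ-guarded} — seat `bsd-potss-k8t-c4` g11; `--supports stmt-BirchSwinnertonDyer-20165`, helper;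
# route-free; CONDITIONAL on the named fact and the two named-print statements; nothing booked, no item closed, BSD is not proved

WHY. k8t-c4 g11 closed the S5 lane of the shared crux to the print boundary: the primed, (B)-only, `ℓ ≠ 2`-guarded reading
`h47P2` of McCallum Prop. 4.4 / Jetchev Prop. 4.7 is a THEOREM modulo `GrossLMS1991.prop37_2_frobeniusCongruence`
(`JetchevIrreducibleProp44.h47P2_of_prop37_2`, p541604), and the H63 chain was re-keyed on `h47P2` over k9-c4 g9's newest
named-print-only line (`…ReadingThm52NamedPrintOnlyPB2`: node ⟸ {h47P2, hPT, hGZ-guarded}). Composing the two gives the planner's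
option (b): DROP S5 from the stub list and bind the fact at the node — this file is that composition, so the re-cut is a one-line
reference. After it the crux reads: 20165 ⟸ S1 (MN19 structure theorem) ∧ S2′ (McCallum 5.2 reading) ∧ S3′ (Jetchev 5.3 reading)
∧ {hPT, hGZ-guarded, Gross 3.7 (2)} ∧ PublishedInputsHeegner.

WHAT IS PROVED. `h63IRowObjectsAddv_of_prop37_2_of_poitouTate_of_GZ31` — statement = `h63IRowObjectsAddv_of_poitouTate_of_GZ31_of_prop47P2` with the binder `h47P2` replaced by
`(h37 : GrossLMS1991.prop37_2_frobeniusCongruence)`; proof = one application. HONEST FRAMING: conditional; nothing booked.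
References: [cite: GrossLMS1991, Prop. 3.7 (2)] [cite: Nekovar2007, Prop. 4.13 (ii)] [cite: McCallumLMS1991, §4 Prop. 4.4]
[cite: Jetchev2008, Thm. 5.2 (p. 821)] [cite: GrossZagier1986, III (3.1)] [cite: MilneADT2006, Ch. I, Thm. 4.10(b)].
-/


set_option autoImplicit false
-- the Theorems directory repeats the summit name (sibling precedent `KatoDescentPotSupersingularAssembly.lean`)
set_option linter.dupNamespace false

noncomputable section

open scoped Classical Pointwise

open WeierstrassCurve IsDedekindDomain NumberField Field Literature.NumberTheory.EllipticCurves
  Literature.NumberTheory.EllipticCurves.ModularForms Literature.NumberTheory.EllipticCurves.Jetchev2008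
  Literature.NumberTheory.GaloisRepresentations Literature.NumberTheory.GaloisCohomology
  Literature.NumberTheory.GaloisRepresentations.DiscreteGaloisModule
  Summit.BirchSwinnertonDyer.Rank1Residual.X11b Summit.BirchSwinnertonDyer.Rank1Residual.X11b.Three
  Summit.BirchSwinnertonDyer.Rank1Residual.JET
  Summit.BirchSwinnertonDyer.Rank1Residual.JET.SelmerVocabulary Literature.NumberTheory.Automorphic

namespace Summit.BirchSwinnertonDyer.BirchSwinnertonDyer.Theorems.JetchevIrreducibleH63P2

/-- **The node with S5 BOUND AS THE PUBLISHED FACT** (planner option (b) of k8t-c4 g11's FINDING §6): the body of `Sig.H63IRowObjectsAddv` (crux 20165) VERBATIM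
from Gross 1991 Prop. 3.7 (2) (`GrossLMS1991.prop37_2_frobeniusCongruence`, image-free named fact, bsd-stepL-lit g24) and the two
named-print statements `hPT` (Poitou–Tate for the tree's Selmer structures) and `hGZ` ([GZ86 III (3.1)] receptacle schema,
Kolyvagin-guarded) — `h63IRowObjectsAddv_of_poitouTate_of_GZ31_of_prop47P2` (this seat, v2 chain) fed with `JetchevIrreducibleProp44.h47P2_of_prop37_2 h37`
(p541604). CONDITIONAL on the three displayed statements; nothing asserted about any curve.
[cite: GrossLMS1991, Prop. 3.7 (2)] [cite: McCallumLMS1991, §4 Prop. 4.4] [cite: Jetchev2008, Thm. 5.2 (p. 821), Prop. 4.7]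
[cite: GrossZagier1986, III (3.1)] [cite: MilneADT2006, Ch. I, Thm. 4.10(b)] -/
theorem h63IRowObjectsAddv_of_prop37_2_of_poitouTate_of_GZ31
    -- NAMED PRINT: [McC] Prop. 4.4 in the irreducible reading (= stub `stub_prop44Irred` of 20165, verbatim)
    (h37 : GrossLMS1991.prop37_2_frobeniusCongruence)
    -- NAMED PRINT: Poitou–Tate duality for the tree's Selmer structures (named fact, bsd-jet ARM P); Gross Prop. 5.3 is no
    -- longer displayed (the sign is a theorem on the irreducible row), nor is any completion-layer gap
    (hPT : ∀ (K : Type) [Field K] [NumberField K], poitouTate_selmerStructure_duality_conj K)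
    -- [GZ86 III (3.1)] in the receptacle form, CLOSED WITH THE PRINTED GUARDS (Heegner field, odd `p` with `E[p]` irreducible
    -- — so `E(ℚ)[p] = 0` and `n′ := #E(ℚ)_tors` is prime to `p` —, square-free conductors `m` with Zhang–Kolyvagin prime factors,
    -- hence `m ≥ 1` prime to `N`: Gross 1991 §3 «n ≥ 1 … prime to N», read-1's `HGZKolyvagin` body; the unguarded `∀ W p m`
    -- closure of p526159/p528465 is SATISFIABILITY-UNVERIFIED, bsd-jet read-1 ADD-9 ANNEX-5 §2)
    (hGZ : ∀ (W : WeierstrassCurve ℚ) [W.IsElliptic] [W.IsGloballyMinimal] [NeZero (W.conductorNorm ℤ)]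
      (K : Type) [Field K] [NumberField K], IsImaginaryQuadratic K →
      SatisfiesHeegnerHypothesis (W.conductorNorm ℤ) K →
      ∀ (p : ℕ) [Fact p.Prime], p ≠ 2 → W.HasIrreducibleModPGaloisRep p →
      ∀ (Dt : ModularParametrizationData W (W.conductorNorm ℤ)) (β : ℤ) (ι : K →+* ℂ)
      [∀ j : ℕ, NumberField (ringClassField K ι j)],
      ∃ n' : ℤ, IsCoprime (p : ℤ) n' ∧ ∀ (m : ℕ), Squarefree m →
        (∀ q ∈ m.primeFactors, Zhang2014.IsKolyvaginPrime (W.conductorNorm ℤ) W K p q) →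
        ∀ (dm : KolyvaginHeegnerData Dt β ι m)
        (γ : ringClassField K ι m ≃ₐ[ℚ] ringClassField K ι m), γ ∈ ringClassGal ι m →
        ∀ v : HeightOneSpectrum (𝓞 K), ¬ (W.baseChange K).HasGoodReductionAt v →
          n' • pointsMap (W.baseChange K) (v.adicCompletion K)
              (dm.toGeomPoints (pointGalHom W (ringClassField K ι m) γ dm.y)) ∈
            E0Receptacle (W.baseChange K) v ∧
          ∀ (ℓ : ℕ), ℓ ∈ m.primeFactors → ∀ (dm' : KolyvaginHeegnerData Dt β ι (m / ℓ))
            (hle : ringClassField K ι (m / ℓ) ≤ ringClassField K ι m),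
            n' • pointsMap (W.baseChange K) (v.adicCompletion K)
                (dm.toGeomPoints (pointGalHom W (ringClassField K ι m) γ
                  (WeierstrassCurve.Affine.Point.map (W' := W)
                    ((RingClassField.inclusion ι hle).restrictScalars ℚ) dm'.y))) ∈
              E0Receptacle (W.baseChange K) v) :
    -- CONCLUSION: the body of `Sig.H63IRowObjectsAddv` (skeleton v4 of crux 20165), verbatim
    ∀ (W : WeierstrassCurve ℚ) [W.IsElliptic] [W.IsGloballyMinimal] [NeZero (W.conductorNorm ℤ)],
    ¬ W.HasCM → ∀ (K : Type) [Field K] [NumberField K], IsImaginaryQuadratic K →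
    NumberField.discr K ≠ -3 → NumberField.discr K ≠ -4 →
    SatisfiesHeegnerHypothesis (W.conductorNorm ℤ) K →
    ∀ (τ : K ≃ₐ[ℚ] K), τ ≠ 1 →
    ∀ (p : ℕ) [Fact p.Prime], p ≠ 2 → Rank1Residual.Addv W p → 0 ≤ padicValRat p W.j →
    W.HasIrreducibleModPGaloisRep p →
    ¬ p ∣ (W.baseChange ℚ_[p]).localTamagawaNumber ℤ_[p] →
    (∀ (q' : ℕ) [Fact q'.Prime], q' ∣ W.conductorNorm ℤ →
      p ∣ (W.baseChange ℚ_[q']).localTamagawaNumber ℤ_[q'] → ¬ q' ^ 2 ∣ W.conductorNorm ℤ) →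
    ∀ (Dt : ModularParametrizationData W (W.conductorNorm ℤ)) (β : ℤ) (ι : K →+* ℂ)
      [∀ k : ℕ, NumberField (ringClassField K ι k)]
      (d₁ : KolyvaginHeegnerData Dt β ι 1), ¬ IsOfFinAddOrder d₁.derivedPoint →
    ∀ (q : ℕ) [Fact q.Prime], q ∣ W.conductorNorm ℤ → ¬ q ^ 2 ∣ W.conductorNorm ℤ → q ≠ p →
    ∀ (mdiv m : {c : ℕ // Squarefree c ∧ ∀ ℓ ∈ c.primeFactors,
        Zhang2014.IsKolyvaginPrime (W.conductorNorm ℤ) W K p ℓ} → ℕ∞),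
    (∀ c (u : ℕ), (u : ℕ∞) ≤ mdiv c ↔ ∀ d : KolyvaginHeegnerData Dt β ι c.1,
      ∃ Q : (W.baseChange (ringClassField K ι c.1)).toAffine.Point,
        ((p ^ u : ℕ) : ℤ) • Q = d.derivedPoint) →
    (∀ c, m c = if mdiv c < Zhang2014.levelIndex W p c.1 then mdiv c else ⊤) →
    ∀ mInf : ℕ, (∀ c, (mInf : ℕ∞) ≤ m c) →
      (∀ m' : ℕ, ∃ c, (m' : ℕ∞) ≤ Zhang2014.levelIndex W p c.1 ∧ m c = mInf) →
    ∀ (k : ℕ) c, 1 ≤ k → Jetchev2008.IsGlobalCoreVertex W K ι τ p k c.1 → m c = mInf →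
      (k : ℕ∞) + mInf ≤ Zhang2014.levelIndex W p c.1 →
      padicValNat p ((W.baseChange ℚ_[q]).localTamagawaNumber ℤ_[q]) < k → mInf < k →
      padicValNat p ((W.baseChange ℚ_[q]).localTamagawaNumber ℤ_[q]) ≤ mInf :=
  h63IRowObjectsAddv_of_poitouTate_of_GZ31_of_prop47P2 (JetchevIrreducibleProp44.h47P2_of_prop37_2 h37) hPT hGZ

end Summit.BirchSwinnertonDyer.BirchSwinnertonDyer.Theorems.JetchevIrreducibleH63P2

end
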